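import Summits.BirchSwinnertonDyer.Rank1Residual.Additive.BudgetFromRelaxedKummerCountJoint
import Summits.BirchSwinnertonDyer.Rank1Residual.Additive.BudgetFromTamagawaWitnesses
import Summits.BirchSwinnertonDyer.Rank1Residual.Additive.AdditiveTamagawaWitness
import Summits.BirchSwinnertonDyer.Rank1Residual.Additive.SplitMultiplicativeWitnessOfTamagawa
import HarnessLib

/-!
# The JOINT Route-G budget at level `0`: `BudgetLeLambdaAt p W (#T₀ + s₀)` from Tamagawa
# witnesses AND strict Selmer classes (row T-E3g-JOINT, FILE J-B; r2's ST-18.2 / ST-20.6;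
# seat p10 GEN 5)

HONEST FRAMING (cell `b2b-bsdres`, run/shared/lean/b2b/bsd-rank1-residual/, verbatim in every
file): the goal of the cell is to DELETE the COMBINATION-SHAPED residual classes of the
Birch–Swinnerton-Dyer formula for ALL analytic-rank `≤ 1` elliptic curves over `ℚ` — "full BSD
formula for every rank `≤ 1` curve in class `C`" assembled STRICTLY from published theorems — so
that the rank-`≤ 1` remainder becomes exactly the CONSTRUCTION-SHAPED classes, which are TYPED
(missing-input `Prop`s), NOT attempted. This is not "finishing BSD". Team n1011 (N10/N11, the
Route-G LOWER budget node of the CONSTRUCTION-SHAPED classes X3♯/X4♯): research route; a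
SIZING / supplier theorem, OPTIONAL per ROUTE-2 II.20 (ST-20.6); nothing is booked by this file;
no mark / label moved. THEOREMS ONLY: no definition, no named fact, no `sorry`; the strict-class
count enters as a HYPOTHESIS per row (census literal), never as a fact.

## What (ROUTE-2 II.18.4 (b): `b₀ = t₀ + s₀ ≤ λ`)

Row T-E3g-BUD0 (`BudgetFromTamagawaWitnesses`, p267137) gave `BudgetLeLambdaAt p W #T₀` from
`#T₀` Tamagawa witnesses over `ℚ`; ARM σ (n1011-p16, `BudgetFromSelmerGroup`) gave
`BudgetLeLambdaAt p W b` from `p^b ≤ #Sel_p(E/ℚ)`.  The JOINT door (FILE J-A) counts both at once: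
the relaxed-Kummer Selmer group `H¹_𝓖` contains `p^{#T₀} · #S₀` classes, `S₀` = the Selmer classes
of `E[p]` that are locally TRIVIAL at the witness places `T₀`.  Hence:

* `exists_finset_layerZero_of_tamagawaWitnesses_joint` (any number field `K`, `E(K)[p] = 0`):
  `p^{#T₀ + s₀}` classes of `A_0[p]` from `#T₀` witnesses and `p^{s₀} ≤ #S₀`;
* `budgetLeLambdaAt_of_tamagawaWitnesses_joint` (over `ℚ`): **`BudgetLeLambdaAt p W (#T₀ + s₀)`**
  modulo BUD0's binders (Greenberg 4.14, PT over `ℚ`, local Euler–Poincaré, `p` odd,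
  `p ∤ #E(ℚ)_tors`) and the census literal `hS₀ : p^{s₀} ≤ #S₀`; `…_joint'` takes `S₀` inside
  `selmerGroup W p` (`= H¹_𝓚`, `selmerGroup_eq_selmerGroup_kummerSelmerStructure`);
  `residualSelmerRankGeAt_of_tamagawaWitnesses_joint` is the residual-count twin.

Census reading (EVIDENCE, r2 II.20.3): `s₀ = d − rk(loc_{T₀})` read off one descent WITH local
images; `b₀ = t₀ + s₀ = 3 = d + 1` on 11 named rows, where this is the only level-`0` route to
`b = 3`.  HONEST LIMITS: level `0` only (the layer-`n` form is the sequel); a lower bound (no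
exactness); `s₀ ≤ d`, and at `s₀ = 0` this is BUD0 verbatim.

References: R. Greenberg, LNM 1716 (1999) §5 pp. 114–118 and Prop. 4.14 [GreenbergLNM1716];
Wiles 1995 Prop. 1.6 / DDT 1997 Thm. 2.19; Milne *ADT* I §6.
-/

set_option autoImplicit false

open scoped Classical
open Function Field NumberField IsDedekindDomain WeierstrassCurve
open Literature.NumberTheory.EllipticCurves Literature.NumberTheory.GaloisRepresentations
open Literature.NumberTheory.GaloisRepresentations.DiscreteGaloisModule (SelmerStructure unramifiedSubgroup)
open Literature.NumberTheory.GaloisCohomology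

namespace Summit.BirchSwinnertonDyer.Rank1Residual.Additive

/-! ### §1 Layer-`0` classes from witnesses and strict classes (any number field) -/

section LayerZero

variable {K : Type} [Field K] [NumberField K] (W : WeierstrassCurve K) [W.IsElliptic] (p : ℕ)
  [hp : Fact p.Prime]

/-- **`#T₀` Tamagawa witnesses and `p^{s₀}` strict-at-`T₀` Selmer classes give `p^{#T₀ + s₀}`
classes of `A_0[p]`** for every cyclotomic `κ`, when `E(K)[p] = 0` and `p` is odd: FILE J-A's
`S = H¹_𝓖(K, E[p])` (`#S ≥ p^{#T₀} · #S₀`) maps injectively into `A_0[p]` by FILE 2 (p264394),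
the local condition over `K_∞` at `v ∈ T₀` being FILE 3b (p264947).
[cite: GreenbergLNM1716, §5 pp. 114–118] -/
theorem exists_finset_layerZero_of_tamagawaWitnesses_joint (hodd : p ≠ 2)
    (hK : ∀ P : W.toAffine.Point, p • P = 0 → P = 0)
    (inv : LocalInvariants K p) (hperf : inv.IsPerfect) (hsum : inv.SumLocalTermEqZero)
    (hcompl : inv.SelmerComplement)
    (hEP : ∀ v : HeightOneSpectrum (𝓞 K), localEulerPoincareCharacteristic (v.adicCompletion K))
    (T₀ : Finset (HeightOneSpectrum (𝓞 K))) (hT₀p : ∀ v ∈ T₀, ((p : ℕ) : 𝓞 K) ∉ v.asIdeal)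
    (hwit : ∀ v ∈ T₀, ∃ u ∈ unramifiedSubgroup
        ((W.torsionGaloisModule (p : ℤ)).restrictField (v.adicCompletion K)) 1,
      u ∉ W.kummerLocalConditionAt (p : ℤ) (v.adicCompletion K))
    (s₀ : ℕ) (hS₀ : p ^ s₀ ≤ Nat.card {x : (W.kummerSelmerStructure (p : ℤ)).selmerGroup //
      ∀ v ∈ T₀, galoisCohomology.localization (W.torsionGaloisModule (p : ℤ)) (Sum.inr v) 1
        (x : galoisCohomology (W.torsionGaloisModule (p : ℤ)) 1) = 0})
    (κ : ZpExtension K p) (hκ : κ.IsCyclotomic) :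
    ∃ s : Finset {z : W.selmerInftyPreimage κ 0 // p • z = 0}, p ^ (T₀.card + s₀) ≤ s.card := by
  obtain ⟨S, hSfin, hcard, hS⟩ :=
    exists_addSubgroup_relaxedKummer_joint W p hodd inv hperf hsum hcompl hEP T₀ hwit
  haveI := hSfin
  obtain ⟨s, hs⟩ := exists_finset_torsion_selmerInftyPreimage_zero_card_eq W p κ hK S
    (↑T₀ : Set (HeightOneSpectrum (𝓞 K))) (fun y hy v hv ↦ (hS y hy).1 v hv)
    (fun y hy w ↦ (hS y hy).2.1 w) fun y hy v hv ↦
      layerToInfty_resH1Hom_torsionToPrimaryH1_mem_localKerOver_of_mem_unramified_sup_kummer W p κ v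
        (hT₀p v hv) (exists_apply_resGal_ne_one_of_isCyclotomic κ hκ v (hT₀p v hv)) y
        ((hS y hy).2.2 v hv)
  refine ⟨s, hs ▸ ?_⟩
  rw [pow_add]
  exact (Nat.mul_le_mul_left _ hS₀).trans hcard

omit [W.IsElliptic] hp in
/-- The strict-at-`T₀` classes counted inside `Sel_p(E/K) = selmerGroup W p` or inside
`H¹_𝓚(K, E[p])` are the same (`selmerGroup_eq_selmerGroup_kummerSelmerStructure`). [folklore] -/
theorem natCard_strict_selmerGroup_eq (T₀ : Finset (HeightOneSpectrum (𝓞 K))) :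
    Nat.card {x : selmerGroup W (p : ℤ) //
      ∀ v ∈ T₀, galoisCohomology.localization (W.torsionGaloisModule (p : ℤ)) (Sum.inr v) 1
        x.1 = 0} =
    Nat.card {x : (W.kummerSelmerStructure (p : ℤ)).selmerGroup //
      ∀ v ∈ T₀, galoisCohomology.localization (W.torsionGaloisModule (p : ℤ)) (Sum.inr v) 1
        (x : galoisCohomology (W.torsionGaloisModule (p : ℤ)) 1) = 0} :=
  Nat.card_congr (Equiv.subtypeEquiv
    (AddEquiv.addSubgroupCongr (selmerGroup_eq_selmerGroup_kummerSelmerStructure W (p : ℤ))).toEquiv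
    fun _ ↦ Iff.rfl)

end LayerZero

/-! ### §2 The joint budget over `ℚ` -/

section Budget

variable {W : WeierstrassCurve ℚ} [W.IsElliptic] [W.IsGloballyMinimal] {p : ℕ} [hp : Fact p.Prime]

/-- **T-E3g-JOINT: the JOINT Route-G budget at level `0`.** For an odd prime `p` with
`p ∤ #E(ℚ)_tors`, a finite set `T₀` of primes `v ∤ p` each carrying a Tamagawa witness (an
unramified non-Kummer class in `H¹(ℚ_v, E[p])`), and `s₀` with `p^{s₀} ≤ #S₀`, `S₀` = the classes
of `H¹_𝓚(ℚ, E[p]) = Sel_p(E/ℚ)` locally trivial at every `v ∈ T₀`: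
**`BudgetLeLambdaAt p W (#T₀ + s₀)`** — `λ(X(E/ℚ_∞)) ≥ #T₀ + s₀` for every torsion Selmer-dual
datum with `μ = 0`.  Image-free.  Modulo the tree's named facts: Poitou–Tate duality for Selmer
structures over `ℚ`, the local Euler–Poincaré formula, Greenberg's Prop. 4.14.
[cite: GreenbergLNM1716, §5 pp. 114–118 and Prop. 4.14] -/
theorem budgetLeLambdaAt_of_tamagawaWitnesses_joint (hodd : p ≠ 2)
    (h414 : Greenberg1999.prop414_noFiniteSubmodule_of_not_dvd_torsionOrder)
    (hPT : poitouTate_selmerStructure_duality ℚ)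
    (hEP : ∀ v : HeightOneSpectrum (𝓞 ℚ), localEulerPoincareCharacteristic (v.adicCompletion ℚ))
    (htors : ¬ p ∣ W.torsionOrder)
    (T₀ : Finset (HeightOneSpectrum (𝓞 ℚ))) (hT₀p : ∀ v ∈ T₀, ((p : ℕ) : 𝓞 ℚ) ∉ v.asIdeal)
    (hwit : ∀ v ∈ T₀, ∃ u ∈ unramifiedSubgroup
        ((W.torsionGaloisModule (p : ℤ)).restrictField (v.adicCompletion ℚ)) 1,
      u ∉ W.kummerLocalConditionAt (p : ℤ) (v.adicCompletion ℚ))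
    (s₀ : ℕ) (hS₀ : p ^ s₀ ≤ Nat.card {x : (W.kummerSelmerStructure (p : ℤ)).selmerGroup //
      ∀ v ∈ T₀, galoisCohomology.localization (W.torsionGaloisModule (p : ℤ)) (Sum.inr v) 1
        (x : galoisCohomology (W.torsionGaloisModule (p : ℤ)) 1) = 0}) :
    BudgetLeLambdaAt p W (T₀.card + s₀) := by
  haveI : NeZero p := ⟨hp.out.ne_zero⟩
  obtain ⟨inv, hperf, hsum, -, hcompl⟩ := hPT p
  have hA : ∀ (κ : ZpExtension ℚ p), κ.IsCyclotomic →
      ∃ s : Finset {y : W.selmerInftyPreimage κ 0 // p • y = 0}, p ^ (T₀.card + s₀) ≤ s.card :=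
    fun κ hκ ↦ exists_finset_layerZero_of_tamagawaWitnesses_joint W p hodd
      (fun P hP ↦ forall_smul_eq_zero_of_not_dvd_torsionOrder W p htors P (by convert hP))
      inv hperf hsum hcompl hEP T₀ hT₀p hwit s₀ hS₀ κ hκ
  intro κ γ hκ hγ hT D _ hXt hμ
  exact budgetLeLambdaAt_of_prop414_of_layerClasses h414 htors 0 hA hκ hγ hT D hXt hμ

/-- **The joint budget, `Sel_p` currency**: as `budgetLeLambdaAt_of_tamagawaWitnesses_joint` with
the strict classes counted inside `selmerGroup W p` (ARM σ's currency).
[cite: GreenbergLNM1716, §5 pp. 114–118 and Prop. 4.14] -/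
theorem budgetLeLambdaAt_of_tamagawaWitnesses_joint' (hodd : p ≠ 2)
    (h414 : Greenberg1999.prop414_noFiniteSubmodule_of_not_dvd_torsionOrder)
    (hPT : poitouTate_selmerStructure_duality ℚ)
    (hEP : ∀ v : HeightOneSpectrum (𝓞 ℚ), localEulerPoincareCharacteristic (v.adicCompletion ℚ))
    (htors : ¬ p ∣ W.torsionOrder)
    (T₀ : Finset (HeightOneSpectrum (𝓞 ℚ))) (hT₀p : ∀ v ∈ T₀, ((p : ℕ) : 𝓞 ℚ) ∉ v.asIdeal)
    (hwit : ∀ v ∈ T₀, ∃ u ∈ unramifiedSubgroup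
        ((W.torsionGaloisModule (p : ℤ)).restrictField (v.adicCompletion ℚ)) 1,
      u ∉ W.kummerLocalConditionAt (p : ℤ) (v.adicCompletion ℚ))
    (s₀ : ℕ) (hS₀ : p ^ s₀ ≤ Nat.card {x : selmerGroup W (p : ℤ) //
      ∀ v ∈ T₀, galoisCohomology.localization (W.torsionGaloisModule (p : ℤ)) (Sum.inr v) 1
        x.1 = 0}) :
    BudgetLeLambdaAt p W (T₀.card + s₀) :=
  budgetLeLambdaAt_of_tamagawaWitnesses_joint hodd h414 hPT hEP htors T₀ hT₀p hwit s₀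
    (by rwa [natCard_strict_selmerGroup_eq] at hS₀)

/-- **The joint residual count**: with `Sel_{p^∞}(E/ℚ_∞)[p]` finite for the cyclotomic `κ`,
`ResidualSelmerRankGeAt p W (#T₀ + s₀)` (`#Sel_{p^∞}(E/ℚ_∞)[p] ≥ p^{#T₀ + s₀}`), via FILE 1's
`residualSelmerRankGeAt_of_layerClasses`. [cite: GreenbergLNM1716, §5 pp. 114–118] -/
theorem residualSelmerRankGeAt_of_tamagawaWitnesses_joint (hodd : p ≠ 2)
    (hPT : poitouTate_selmerStructure_duality ℚ)
    (hEP : ∀ v : HeightOneSpectrum (𝓞 ℚ), localEulerPoincareCharacteristic (v.adicCompletion ℚ))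
    (htors : ¬ p ∣ W.torsionOrder)
    (hfin : ∀ (κ : ZpExtension ℚ p), κ.IsCyclotomic →
      Finite {s : W.selmerInfty κ // p • s = 0})
    (T₀ : Finset (HeightOneSpectrum (𝓞 ℚ))) (hT₀p : ∀ v ∈ T₀, ((p : ℕ) : 𝓞 ℚ) ∉ v.asIdeal)
    (hwit : ∀ v ∈ T₀, ∃ u ∈ unramifiedSubgroup
        ((W.torsionGaloisModule (p : ℤ)).restrictField (v.adicCompletion ℚ)) 1,
      u ∉ W.kummerLocalConditionAt (p : ℤ) (v.adicCompletion ℚ))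
    (s₀ : ℕ) (hS₀ : p ^ s₀ ≤ Nat.card {x : (W.kummerSelmerStructure (p : ℤ)).selmerGroup //
      ∀ v ∈ T₀, galoisCohomology.localization (W.torsionGaloisModule (p : ℤ)) (Sum.inr v) 1
        (x : galoisCohomology (W.torsionGaloisModule (p : ℤ)) 1) = 0}) :
    ResidualSelmerRankGeAt p W (T₀.card + s₀) := by
  haveI : NeZero p := ⟨hp.out.ne_zero⟩
  obtain ⟨inv, hperf, hsum, -, hcompl⟩ := hPT p
  have hA : ∀ (κ : ZpExtension ℚ p), κ.IsCyclotomic →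
      ∃ s : Finset {y : W.selmerInftyPreimage κ 0 // p • y = 0}, p ^ (T₀.card + s₀) ≤ s.card :=
    fun κ hκ ↦ exists_finset_layerZero_of_tamagawaWitnesses_joint W p hodd
      (fun P hP ↦ forall_smul_eq_zero_of_not_dvd_torsionOrder W p htors P (by convert hP))
      inv hperf hsum hcompl hEP T₀ hT₀p hwit s₀ hS₀ κ hκ
  intro κ hκ
  exact residualSelmerRankGeAt_of_layerClasses htors 0 hfin hA hκ


/-! ### §3 The joint budget from census certificates (level `0`) -/

/-- **T-E3g-JOINT from CENSUS CERTIFICATES (level `0`).** Let `E = W/ℚ` be globally minimal, `p`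
an odd prime with `p ∤ #E(ℚ)_tors`, and `S` a finite set of places `v` of `ℚ`, each with `v ∤ p`,
`p ∣ c_v` and additive OR split multiplicative reduction at `v` (rows T-E3g-ADD / T-L1-KN supply
the Tamagawa witness at `v`, the split rows modulo A40 `hU`); let `s₀` satisfy
`p^{s₀} ≤ #{x ∈ Sel_p(E/ℚ) : loc_v x = 0 for all v ∈ S}` (census literal: the exhibited Selmer
classes locally trivial on `S`).  Then, modulo Greenberg 4.14 (`h414`), Poitou–Tate duality over
`ℚ` (`hPT`), the local Euler–Poincaré formula (`hEP`) and A40 (`hU`, split rows only):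
**`BudgetLeLambdaAt p W (#S + s₀)`**.  On r2's 11 named rows (II.20.3; all level-`0`-full) this
reads `b₀ = t₀ + s₀ = 3`. [cite: GreenbergLNM1716, §5 pp. 114–118 and Prop. 4.14]
[cite: SilvermanATAEC1994, Ch. V Thm. 3.1 (c),(d), Thm. 5.3 (a),(b) and Ex. 5.13] -/
theorem budgetLeLambdaAt_of_certificates_joint (hodd : p ≠ 2)
    (h414 : Greenberg1999.prop414_noFiniteSubmodule_of_not_dvd_torsionOrder)
    (hPT : poitouTate_selmerStructure_duality ℚ)
    (hEP : ∀ v : HeightOneSpectrum (𝓞 ℚ), localEulerPoincareCharacteristic (v.adicCompletion ℚ))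
    (htors : ¬ p ∣ W.torsionOrder) (hU : Silverman1994_thmV53_tateUniformisation.{0})
    (S : Finset (HeightOneSpectrum (𝓞 ℚ))) (hSp : ∀ v ∈ S, ((p : ℕ) : 𝓞 ℚ) ∉ v.asIdeal)
    (hcv : ∀ v ∈ S,
      p ∣ (W.baseChange (v.adicCompletion ℚ)).localTamagawaNumber (v.adicCompletionIntegers ℚ))
    (hdat : ∀ v ∈ S, W.HasAdditiveReductionAt v ∨ W.HasSplitMultiplicativeReductionAt v)
    (s₀ : ℕ) (hS₀ : p ^ s₀ ≤ Nat.card {x : selmerGroup W (p : ℤ) //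
      ∀ v ∈ S, galoisCohomology.localization (W.torsionGaloisModule (p : ℤ)) (Sum.inr v) 1
        x.1 = 0}) :
    BudgetLeLambdaAt p W (S.card + s₀) :=
  budgetLeLambdaAt_of_tamagawaWitnesses_joint' hodd h414 hPT hEP htors S hSp
    (fun v hv ↦ by
      rcases hdat v hv with hadd | hsplit
      · exact exists_mem_unramifiedSubgroup_not_mem_kummerLocalConditionAt_of_hasAdditiveReductionAt
          W p v (hSp v hv) hodd hadd (hcv v hv)
      · exact exists_mem_unramifiedSubgroup_not_mem_kummerLocalConditionAt_of_tateUniformisation_of_split_of_dvd_localTamagawaNumber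
          W p v hU hsplit (hSp v hv) (hcv v hv))
    s₀ hS₀

end Budget

end Summit.BirchSwinnertonDyer.Rank1Residual.Additive
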